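import Summits.CriticalPhenomena.PercolationContinuityZ3.Theorems.Transplant.SkelFrmBParamsSlotsT
import Summits.CriticalPhenomena.PercolationContinuityZ3.Theorems.Transplant.SkelNegBParamsSlotsT
import Summits.CriticalPhenomena.PercolationContinuityZ3.Theorems.Transplant.SkelFrmBParamsSched
import Summits.CriticalPhenomena.PercolationContinuityZ3.Theorems.Transplant.SkelNegBParamsSched
import Summits.CriticalPhenomena.PercolationContinuityZ3.Theorems.Transplant.SkelPhiRootBridgeData
import Summits.CriticalPhenomena.PercolationContinuityZ3.Theorems.Transplant.SkelFrm1SlotTypes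
import Summits.CriticalPhenomena.PercolationContinuityZ3.Theorems.Transplant.SkelFrm1ParamsPO
import Summits.CriticalPhenomena.PercolationContinuityZ3.Theorems.Transplant.SkelFrm1ParamsLBL
import Summits.CriticalPhenomena.PercolationContinuityZ3.Theorems.Transplant.SkelFrmBParamsKitA
import Summits.CriticalPhenomena.PercolationContinuityZ3.Theorems.Transplant.SkelFrmBParamsKitS
import Summits.CriticalPhenomena.PercolationContinuityZ3.Theorems.Transplant.SkelFrm1ParamsLF
import Summits.CriticalPhenomena.PercolationContinuityZ3.Theorems.Transplant.SkelFrm1ParamsLO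
import Summits.CriticalPhenomena.PercolationContinuityZ3.Theorems.Transplant.SkelFrmBParamsLF
import Summits.CriticalPhenomena.PercolationContinuityZ3.Theorems.Transplant.SkelFrmBParamsFineSize
import Summits.CriticalPhenomena.PercolationContinuityZ3.Theorems.Transplant.SkelFrmBParamsLO
import Summits.CriticalPhenomena.PercolationContinuityZ3.Theorems.Transplant.SkelFrmBParamsB
import Summits.CriticalPhenomena.PercolationContinuityZ3.Theorems.Transplant.SkelFrmBParamsSlotsR
import Summits.CriticalPhenomena.PercolationContinuityZ3.Theorems.Transplant.SkelFrmBParamsSlotsRS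
import Summits.CriticalPhenomena.PercolationContinuityZ3.Theorems.Transplant.SkelFrmBParamsSlots
import Summits.CriticalPhenomena.PercolationContinuityZ3.Theorems.Transplant.SkelFrmBParamsReachFC
import Summits.CriticalPhenomena.PercolationContinuityZ3.Theorems.Transplant.SkelNegBParamsRootLam
import Summits.CriticalPhenomena.PercolationContinuityZ3.Theorems.Transplant.PlanarSkeletonFrmDefs
import Summits.CriticalPhenomena.PercolationContinuityZ3.Theorems.Transplant.SkelPhiStepIDataNS
import HarnessLib

/-!
# N2 (frames-only node `SamePDropOfSkeletonFrm₁`, OPEN) params column over `PlanarSkeletonFrm` — (ζ″) ledger, shape (B′) of record ((R-14)):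
# MECHANICAL PORT of N1's `SkelNegBParamsRootLam` — chain of record `NegB`, part RootLam: THE NEAR-ROOT FOOTPRINTS OF THE ROOT RESIDUE READ BY THE LATTICE FUNCTIONALS —
# values `NegB.KS.eR` (the collar `RA′ + pr`), `ΛR₀, ΛR₁` (bounds of `v_β·Δ₀ − v_L·Δ₁` and `n_L·Δ₁ − h_L·Δ₀` over the bridge region AND the hop prism), `kR₀, kR₁` (their
# fine … (N1 title abridged; see `SkelNegBParamsRootLam`)
builds on p205010 (kernel theorem, internal audit signed; external expert review pending) — nothing in this file uses p205010; NOTHING is claimed about the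
open node `SamePDropOfSkeletonFrm₁` (`SamePDropOfSkeletonNeg₁` is CLOSED in the tree and untouched by this file).
Status sentence (coordinator 2026-08-20T04:30Z): "θ(p_c) = 0 on ℤ^d, all d ≥ 2 — kernel-verified (Lean 4/Mathlib, standard axioms); internal adversarial
audit SIGNED 2026-08-20 04:29Z; external expert review pending."
Lane `prim-bschramm-*`, seat `prim-bschramm-stmt` (gen 19); helper file (`--supports stmt-CriticalPhenomena-4575 --as helper`); ledger HOME/prim-bschramm-stmt/FRM-PARAMS.md §9, (R-14).
PORT RULES (HOME/prim-bschramm-stmt-g19/lean/port_frm.py, the tool of record per (R-14)): outer namespace `PlanarSkeletonNeg ↦ PlanarSkeletonFrm`, carrier binder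
`(Φ : PlanarSkeletonFrm G)`, record binder `(D : Skelφ.StepI.DataNS V)` (the selectors travel IN the record, `SkelPhiStepIDataNS`); section variables INLINED into every
declaration header; inner namespaces (`Neg`/`NegB`/`KS`/…) and every short name KEPT so all cross-references resolve unchanged; declarations using no section variable are
NOT re-declared (N1's originals are referenced fully qualified). Mathematical content, proofs, docstrings and citations are N1's, verbatim, except where stated next.
SELECTORS IN THIS FILE ((R-14) condition of record — joint selection, `D.sN`'s first argument is the literal handed to `D.sM`): none (pure port; the pairs are read through their N1 names).
N1 HEADER (kept for the reader):
helper file (`--supports stmt-CriticalPhenomena-4575 --as helper`); ledger HOME/prim-bschramm-stmt/NEG-PARAMS.md v0.13.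
* §1 values `KS.prB`, `KS.eR`, `KS.ΛR₀`, `KS.ΛR₁`, `KS.kR₀`, `KS.kR₁` (any `(g, f)`, kit index `mk`); `abs_vβL_le`, `Dof_eq_sq_mul`;
* §2 **`hΛR_R`** (the region of `bridgeSame/TrSide/TrTop` — one statement, the three regions coincide: `region_eq_*`), **`hΛQ_R`**, **`hkR0_R/hkR1_R`**;
* §3 at `g := gT mk gx`: `five_eR_le_ML`, `ΛR₀_le/ΛR₁_le` (`≤ 8m`), `kR_le` (`kR_i ≤ 8Kq s_i + 1`), **`hfR_R`** (both direction families).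
[cite: KozmaNitzan2024, §4 p. 28 ((32) at the root), Lemma 10 Step IV] [cite: MartineauTassion2017, §3.2, §4.3]
-/

noncomputable section

open scoped Classical

namespace Summit.CriticalPhenomena.PercolationContinuityZ3.Theorems.Transplant

namespace PlanarSkeletonFrm

namespace NegB

open Literature.Probability.Percolation Literature.Probability.LatticeModels SimpleGraph
open SkelConc (Consts)
open Skelφ (pgScale)
open Skelφ.StepI (DataN)
open ChainPlanar (BridgePrm)
open TwoAxis.Para (modulus)
open Neg

/-! ## §1 The values -/

section Lattice

/-- **`|v_β| ≤ ℓ_L + 10·n_L + 1`** (`n_L v_β = m + h_L v_L`, `m ≤ n_Lℓ_L`, `|h_L| ≤ 10n_L`, `|v_L| ≤ n_L`). [folklore] -/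
theorem abs_vβL_le (κ : Consts) {V : Type} [DecidableEq V] [Countable V] {G : SimpleGraph V} [G.LocallyFinite] (Φ : PlanarSkeletonFrm G) (t : V) (p : unitInterval) (D : Skelφ.StepI.DataNS V) (g : ℕ) (f : ℕ) (hN : EqNumL κ Φ t p D g f) (hκ : (hL κ Φ t p D g f).natAbs ≤ 10 * nL κ Φ t p D g f) :
    |vβL κ Φ t p D g f| ≤ (ℓL κ Φ t p D g f : ℤ) + 10 * nL κ Φ t p D g f + 1 := by
  obtain ⟨hn1, -⟩ := one_le_of_eqNumL κ Φ t p D g f hN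
  have hv : |vL κ Φ t p D g f| ≤ nL κ Φ t p D g f := hN.v_le
  have hm := Skelφ.NegPrm.modulus_vβOf hn1 (hL κ Φ t p D g f) (ℓL κ Φ t p D g f) (vL κ Φ t p D g f)
  have hκ' : |hL κ Φ t p D g f| ≤ 10 * (nL κ Φ t p D g f : ℤ) := by rw [← Int.natCast_natAbs]; exact_mod_cast hκ
  have hn0 : (0 : ℤ) < nL κ Φ t p D g f := by exact_mod_cast hn1
  unfold TwoAxis.Para.modulus at hm
  have e : vβL κ Φ t p D g f = Skelφ.NegPrm.vβOf (nL κ Φ t p D g f) (hL κ Φ t p D g f) (ℓL κ Φ t p D g f) (vL κ Φ t p D g f) := rfl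
  rw [← e] at hm
  have hhv : |hL κ Φ t p D g f * vL κ Φ t p D g f| ≤ 10 * (nL κ Φ t p D g f : ℤ) * nL κ Φ t p D g f := by
    rw [abs_mul]; exact mul_le_mul hκ' hv (abs_nonneg _) (by positivity)
  obtain ⟨hlo, hhi⟩ := abs_le.1 hhv
  rw [abs_le]
  constructor
  · have h1 : (nL κ Φ t p D g f : ℤ) * (-(10 * nL κ Φ t p D g f + 1)) < nL κ Φ t p D g f * vβL κ Φ t p D g f := by nlinarith
    have h2 := lt_of_mul_lt_mul_left h1 hn0.le
    have hℓ : (0 : ℤ) ≤ ℓL κ Φ t p D g f := by positivity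
    linarith
  · have h1 : (nL κ Φ t p D g f : ℤ) * vβL κ Φ t p D g f ≤ nL κ Φ t p D g f * (ℓL κ Φ t p D g f + 10 * nL κ Φ t p D g f) := by nlinarith
    have h2 := le_of_mul_le_mul_left h1 hn0
    linarith

/-- `Dof = 800² · m`. [folklore] -/
theorem Dof_eq_sq_mul (κ : Consts) {V : Type} [DecidableEq V] [Countable V] {G : SimpleGraph V} [G.LocallyFinite] (Φ : PlanarSkeletonFrm G) (t : V) (p : unitInterval) (D : Skelφ.StepI.DataNS V) (g : ℕ) (f : ℕ) : Skelφ.NegPrm.Dof (nL κ Φ t p D g f) (hL κ Φ t p D g f) (ℓL κ Φ t p D g f) (vL κ Φ t p D g f) =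
    800 ^ 2 * modulus (nL κ Φ t p D g f) (hL κ Φ t p D g f) (vL κ Φ t p D g f) (vβL κ Φ t p D g f) := rfl

end Lattice

namespace KS

section Values

/-- The bridge stride's prism bound `pr := pgScale n_b h_b (3ℓ_b)` (the `pr` field of all three B.13 frames). [this work] -/
def prB (κ : Consts) {V : Type} [Countable V] {G : SimpleGraph V} [G.LocallyFinite] (Φ : PlanarSkeletonFrm G) (t : V) (p : unitInterval) (D : Skelφ.StepI.DataNS V) (mk : ℕ) : ℕ := pgScale (nBR κ Φ t p D mk) (hBR κ Φ t p D mk) (3 * ℓBR κ Φ t p D mk)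

/-- **The collar** `e := RA′ + pr` of the bridge region about the hop's landing box. [this work] -/
def eR (κ : Consts) {V : Type} [Countable V] {G : SimpleGraph V} [G.LocallyFinite] (Φ : PlanarSkeletonFrm G) (t : V) (p : unitInterval) (D : Skelφ.StepI.DataNS V) (mk : ℕ) : ℕ := RA' κ Φ t p D mk + prB κ Φ t p D mk

/-- **`ΛR₀ := m + 3n_Lℓ_L + |v_β|·e + |v_L|·(ℓ_L + e)`** (bound of `v_β·Δ₀ − v_L·Δ₁` over the bridge region and the hop prism). [this work] -/
def ΛR₀ (κ : Consts) {V : Type} [DecidableEq V] [Countable V] {G : SimpleGraph V} [G.LocallyFinite] (Φ : PlanarSkeletonFrm G) (t : V) (p : unitInterval) (D : Skelφ.StepI.DataNS V) (g : ℕ) (f : ℕ) (mk : ℕ) : ℤ := modulus (nL κ Φ t p D g f) (hL κ Φ t p D g f) (vL κ Φ t p D g f) (vβL κ Φ t p D g f) + 3 * (nL κ Φ t p D g f : ℤ) * ℓL κ Φ t p D g f +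
  |vβL κ Φ t p D g f| * eR κ Φ t p D mk + |vL κ Φ t p D g f| * ((ℓL κ Φ t p D g f : ℤ) + eR κ Φ t p D mk)

/-- **`ΛR₁ := 4n_Lℓ_L + (n_L + |h_L|)·e`** (bound of `n_L·Δ₁ − h_L·Δ₀`). [this work] -/
def ΛR₁ (κ : Consts) {V : Type} [DecidableEq V] [Countable V] {G : SimpleGraph V} [G.LocallyFinite] (Φ : PlanarSkeletonFrm G) (t : V) (p : unitInterval) (D : Skelφ.StepI.DataNS V) (g : ℕ) (f : ℕ) (mk : ℕ) : ℤ := 4 * (nL κ Φ t p D g f : ℤ) * ℓL κ Φ t p D g f + ((nL κ Φ t p D g f : ℤ) + |hL κ Φ t p D g f|) * eR κ Φ t p D mk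

/-- **`kR₀ := ⌈c₀·|A|·ΛR₀ / D⌉`** (floor + 1). [this work] -/
def kR₀ (κ : Consts) {V : Type} [DecidableEq V] [Countable V] {G : SimpleGraph V} [G.LocallyFinite] (Φ : PlanarSkeletonFrm G) (t : V) (p : unitInterval) (D : Skelφ.StepI.DataNS V) (g : ℕ) (f : ℕ) (mk : ℕ) : ℤ := (prF κ Φ t p D g f).c₀ * (|(prF κ Φ t p D g f).A| * ΛR₀ κ Φ t p D g f mk) / (prF κ Φ t p D g f).D + 1

/-- **`kR₁ := ⌈c₁·|A|·ΛR₁ / D⌉`** (floor + 1). [this work] -/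
def kR₁ (κ : Consts) {V : Type} [DecidableEq V] [Countable V] {G : SimpleGraph V} [G.LocallyFinite] (Φ : PlanarSkeletonFrm G) (t : V) (p : unitInterval) (D : Skelφ.StepI.DataNS V) (g : ℕ) (f : ℕ) (mk : ℕ) : ℤ := (prF κ Φ t p D g f).c₁ * (|(prF κ Φ t p D g f).A| * ΛR₁ κ Φ t p D g f mk) / (prF κ Φ t p D g f).D + 1

/-- `0 ≤ e`, `0 ≤ ΛR₀ − (m + 3n_Lℓ_L)`-type positivity facts. [folklore] -/
theorem ΛR_nonneg (κ : Consts) {V : Type} [DecidableEq V] [Countable V] {G : SimpleGraph V} [G.LocallyFinite] (Φ : PlanarSkeletonFrm G) (t : V) (p : unitInterval) (D : Skelφ.StepI.DataNS V) (g : ℕ) (f : ℕ) (mk : ℕ) (hN : EqNumL κ Φ t p D g f) : 0 ≤ ΛR₀ κ Φ t p D g f mk ∧ 0 ≤ ΛR₁ κ Φ t p D g f mk := by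
  obtain ⟨hn1, hℓ1⟩ := one_le_of_eqNumL κ Φ t p D g f hN
  have hm : 0 < modulus (nL κ Φ t p D g f) (hL κ Φ t p D g f) (vL κ Φ t p D g f) (vβL κ Φ t p D g f) :=
    Skelφ.NegPrm.modulus_vβOf_pos hn1 hℓ1 _ _
  unfold ΛR₀ ΛR₁
  constructor <;> positivity

/-! ## §2 The four hypotheses of the near-root block -/

/-- **`hkR0`**: `20K s₀·(|800|·ΛR₀) ≤ kR₀·D`. [folklore] -/
theorem hkR0_R (κ : Consts) {V : Type} [DecidableEq V] [Countable V] {G : SimpleGraph V} [G.LocallyFinite] (Φ : PlanarSkeletonFrm G) (t : V) (p : unitInterval) (D : Skelφ.StepI.DataNS V) (g : ℕ) (f : ℕ) (mk : ℕ) (hN : EqNumL κ Φ t p D g f) :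
    20 * ((fcells κ Φ t p D g f).K : ℤ) * (((fcells κ Φ t p D g f).s 0 : ℕ) : ℤ) * (|(800 : ℤ)| * ΛR₀ κ Φ t p D g f mk) ≤
      kR₀ κ Φ t p D g f mk * Skelφ.NegPrm.Dof (nL κ Φ t p D g f) (hL κ Φ t p D g f) (ℓL κ Φ t p D g f) (vL κ Φ t p D g f) := by
  have hD := (prF_pos κ Φ t p D g f hN).2.2.2.2.2
  show (prF κ Φ t p D g f).c₀ * (|(prF κ Φ t p D g f).A| * ΛR₀ κ Φ t p D g f mk) ≤ kR₀ κ Φ t p D g f mk * (prF κ Φ t p D g f).D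
  unfold kR₀
  rw [mul_comm (_ / _ + 1)]
  exact ceil_mul_le hD

/-- **`hkR1`**: `20K s₁·(|800|·ΛR₁) ≤ kR₁·D`. [folklore] -/
theorem hkR1_R (κ : Consts) {V : Type} [DecidableEq V] [Countable V] {G : SimpleGraph V} [G.LocallyFinite] (Φ : PlanarSkeletonFrm G) (t : V) (p : unitInterval) (D : Skelφ.StepI.DataNS V) (g : ℕ) (f : ℕ) (mk : ℕ) (hN : EqNumL κ Φ t p D g f) :
    20 * ((fcells κ Φ t p D g f).K : ℤ) * (((fcells κ Φ t p D g f).s 1 : ℕ) : ℤ) * (|(800 : ℤ)| * ΛR₁ κ Φ t p D g f mk) ≤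
      kR₁ κ Φ t p D g f mk * Skelφ.NegPrm.Dof (nL κ Φ t p D g f) (hL κ Φ t p D g f) (ℓL κ Φ t p D g f) (vL κ Φ t p D g f) := by
  have hD := (prF_pos κ Φ t p D g f hN).2.2.2.2.2
  show (prF κ Φ t p D g f).c₁ * (|(prF κ Φ t p D g f).A| * ΛR₁ κ Φ t p D g f mk) ≤ kR₁ κ Φ t p D g f mk * (prF κ Φ t p D g f).D
  unfold kR₁
  rw [mul_comm (_ / _ + 1)]
  exact ceil_mul_le hD

/-- **`hΛQ0/hΛQ1`**: the hop prism's functional bounds `m + n_L·(3ℓ_L) ≤ ΛR₀`, `n_L·(3ℓ_L) ≤ ΛR₁`. [folklore] -/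
theorem hΛQ_R (κ : Consts) {V : Type} [DecidableEq V] [Countable V] {G : SimpleGraph V} [G.LocallyFinite] (Φ : PlanarSkeletonFrm G) (t : V) (p : unitInterval) (D : Skelφ.StepI.DataNS V) (g : ℕ) (f : ℕ) (mk : ℕ) : modulus (nL κ Φ t p D g f) (hL κ Φ t p D g f) (vL κ Φ t p D g f) (vβL κ Φ t p D g f) + (nL κ Φ t p D g f : ℤ) * ((3 * ℓL κ Φ t p D g f : ℕ) : ℤ) ≤
      ΛR₀ κ Φ t p D g f mk ∧ (nL κ Φ t p D g f : ℤ) * ((3 * ℓL κ Φ t p D g f : ℕ) : ℤ) ≤ ΛR₁ κ Φ t p D g f mk := by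
  unfold ΛR₀ ΛR₁
  have h1 : 0 ≤ |vβL κ Φ t p D g f| * (eR κ Φ t p D mk : ℤ) := by positivity
  have h2 : 0 ≤ |vL κ Φ t p D g f| * ((ℓL κ Φ t p D g f : ℤ) + eR κ Φ t p D mk) := by positivity
  have h3 : 0 ≤ ((nL κ Φ t p D g f : ℤ) + |hL κ Φ t p D g f|) * (eR κ Φ t p D mk : ℤ) := by positivity
  have h4 : (0 : ℤ) ≤ (nL κ Φ t p D g f : ℤ) * ℓL κ Φ t p D g f := by positivity
  push_cast
  constructor <;> nlinarith

/-- The three B.13 frames share the region (same landing box, `R′`, `pr`). [folklore] -/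
theorem region_eq_tr (κ : Consts) {V : Type} [DecidableEq V] [Countable V] {G : SimpleGraph V} [G.LocallyFinite] (Φ : PlanarSkeletonFrm G) (t : V) (p : unitInterval) (D : Skelφ.StepI.DataNS V) (g : ℕ) (f : ℕ) (mk : ℕ) (σ : ℤ) :
    (Skelφ.bridgeTrSide σ (nL κ Φ t p D g f) (hL κ Φ t p D g f) (ℓL κ Φ t p D g f) (RA' κ Φ t p D mk) (nBR κ Φ t p D mk) (hBR κ Φ t p D mk) (ℓBR κ Φ t p D mk)).regionLo =
        (Skelφ.bridgeSame σ (nL κ Φ t p D g f) (hL κ Φ t p D g f) (ℓL κ Φ t p D g f) (RA' κ Φ t p D mk) (nBR κ Φ t p D mk) (hBR κ Φ t p D mk) (ℓBR κ Φ t p D mk)).regionLo ∧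
      (Skelφ.bridgeTrSide σ (nL κ Φ t p D g f) (hL κ Φ t p D g f) (ℓL κ Φ t p D g f) (RA' κ Φ t p D mk) (nBR κ Φ t p D mk) (hBR κ Φ t p D mk) (ℓBR κ Φ t p D mk)).regionHi =
        (Skelφ.bridgeSame σ (nL κ Φ t p D g f) (hL κ Φ t p D g f) (ℓL κ Φ t p D g f) (RA' κ Φ t p D mk) (nBR κ Φ t p D mk) (hBR κ Φ t p D mk) (ℓBR κ Φ t p D mk)).regionHi ∧
      (Skelφ.bridgeTrTop σ (nL κ Φ t p D g f) (hL κ Φ t p D g f) (ℓL κ Φ t p D g f) (RA' κ Φ t p D mk) (nBR κ Φ t p D mk) (hBR κ Φ t p D mk) (ℓBR κ Φ t p D mk)).regionLo =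
        (Skelφ.bridgeSame σ (nL κ Φ t p D g f) (hL κ Φ t p D g f) (ℓL κ Φ t p D g f) (RA' κ Φ t p D mk) (nBR κ Φ t p D mk) (hBR κ Φ t p D mk) (ℓBR κ Φ t p D mk)).regionLo ∧
      (Skelφ.bridgeTrTop σ (nL κ Φ t p D g f) (hL κ Φ t p D g f) (ℓL κ Φ t p D g f) (RA' κ Φ t p D mk) (nBR κ Φ t p D mk) (hBR κ Φ t p D mk) (ℓBR κ Φ t p D mk)).regionHi =
        (Skelφ.bridgeSame σ (nL κ Φ t p D g f) (hL κ Φ t p D g f) (ℓL κ Φ t p D g f) (RA' κ Φ t p D mk) (nBR κ Φ t p D mk) (hBR κ Φ t p D mk) (ℓBR κ Φ t p D mk)).regionHi :=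
  ⟨rfl, rfl, rfl, rfl⟩

/-- The region of `bridgeSame` in coordinates: `[n_L − e, n_L + e] × [σh_L − e, σh_L + ℓ_L + e]`. [folklore] -/
theorem mem_region_iff (κ : Consts) {V : Type} [DecidableEq V] [Countable V] {G : SimpleGraph V} [G.LocallyFinite] (Φ : PlanarSkeletonFrm G) (t : V) (p : unitInterval) (D : Skelφ.StepI.DataNS V) (g : ℕ) (f : ℕ) (mk : ℕ) (σ : ℤ) (x : Site 2) :
    x ∈ Finset.Icc (Skelφ.bridgeSame σ (nL κ Φ t p D g f) (hL κ Φ t p D g f) (ℓL κ Φ t p D g f) (RA' κ Φ t p D mk) (nBR κ Φ t p D mk) (hBR κ Φ t p D mk) (ℓBR κ Φ t p D mk)).regionLo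
        (Skelφ.bridgeSame σ (nL κ Φ t p D g f) (hL κ Φ t p D g f) (ℓL κ Φ t p D g f) (RA' κ Φ t p D mk) (nBR κ Φ t p D mk) (hBR κ Φ t p D mk) (ℓBR κ Φ t p D mk)).regionHi ↔
      ((nL κ Φ t p D g f : ℤ) - eR κ Φ t p D mk ≤ x 0 ∧ x 0 ≤ (nL κ Φ t p D g f : ℤ) + eR κ Φ t p D mk) ∧
        (σ * hL κ Φ t p D g f - eR κ Φ t p D mk ≤ x 1 ∧ x 1 ≤ σ * hL κ Φ t p D g f + ℓL κ Φ t p D g f + eR κ Φ t p D mk) := by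
  have hlo : (Skelφ.bridgeSame σ (nL κ Φ t p D g f) (hL κ Φ t p D g f) (ℓL κ Φ t p D g f) (RA' κ Φ t p D mk) (nBR κ Φ t p D mk) (hBR κ Φ t p D mk) (ℓBR κ Φ t p D mk)).regionLo =
      Skelφ.pt ((nL κ Φ t p D g f : ℤ) - eR κ Φ t p D mk) (σ * hL κ Φ t p D g f - eR κ Φ t p D mk) := by
    funext i; unfold ChainPlanar.BridgePrm.regionLo Skelφ.bridgeSame eR prB
    fin_cases i <;> simp [Skelφ.pt] <;> ring
  have hhi : (Skelφ.bridgeSame σ (nL κ Φ t p D g f) (hL κ Φ t p D g f) (ℓL κ Φ t p D g f) (RA' κ Φ t p D mk) (nBR κ Φ t p D mk) (hBR κ Φ t p D mk) (ℓBR κ Φ t p D mk)).regionHi =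
      Skelφ.pt ((nL κ Φ t p D g f : ℤ) + eR κ Φ t p D mk) (σ * hL κ Φ t p D g f + ℓL κ Φ t p D g f + eR κ Φ t p D mk) := by
    funext i; unfold ChainPlanar.BridgePrm.regionHi Skelφ.bridgeSame eR prB
    fin_cases i <;> simp [Skelφ.pt] <;> ring
  rw [hlo, hhi, Skelφ.mem_Icc_pt_iff]

/-- **`hΛR`**: over the bridge region (any B.13 frame, via `region_eq_tr`), `|v_β·(σx₀) − v_L·x₁| ≤ ΛR₀` and `|n_L·x₁ − h_L·(σx₀)| ≤ ΛR₁` (`σ = ±1`).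
[cite: KozmaNitzan2024, §4 p. 28] -/
theorem hΛR_R (κ : Consts) {V : Type} [DecidableEq V] [Countable V] {G : SimpleGraph V} [G.LocallyFinite] (Φ : PlanarSkeletonFrm G) (t : V) (p : unitInterval) (D : Skelφ.StepI.DataNS V) (g : ℕ) (f : ℕ) (mk : ℕ) (hN : EqNumL κ Φ t p D g f) {σ : ℤ} (hσ : σ = 1 ∨ σ = -1) :
    ∀ x ∈ Finset.Icc (Skelφ.bridgeSame σ (nL κ Φ t p D g f) (hL κ Φ t p D g f) (ℓL κ Φ t p D g f) (RA' κ Φ t p D mk) (nBR κ Φ t p D mk) (hBR κ Φ t p D mk) (ℓBR κ Φ t p D mk)).regionLo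
        (Skelφ.bridgeSame σ (nL κ Φ t p D g f) (hL κ Φ t p D g f) (ℓL κ Φ t p D g f) (RA' κ Φ t p D mk) (nBR κ Φ t p D mk) (hBR κ Φ t p D mk) (ℓBR κ Φ t p D mk)).regionHi,
      |vβL κ Φ t p D g f * (σ * x 0) - vL κ Φ t p D g f * x 1| ≤ ΛR₀ κ Φ t p D g f mk ∧
        |(nL κ Φ t p D g f : ℤ) * x 1 - hL κ Φ t p D g f * (σ * x 0)| ≤ ΛR₁ κ Φ t p D g f mk := by
  intro x hx
  rw [mem_region_iff] at hx
  obtain ⟨⟨h0l, h0u⟩, ⟨h1l, h1u⟩⟩ := hx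
  obtain ⟨hn1, hℓ1⟩ := one_le_of_eqNumL κ Φ t p D g f hN
  have hm : 0 < modulus (nL κ Φ t p D g f) (hL κ Φ t p D g f) (vL κ Φ t p D g f) (vβL κ Φ t p D g f) := Skelφ.NegPrm.modulus_vβOf_pos hn1 hℓ1 _ _
  have hσsq : σ * σ = 1 := by rcases hσ with h | h <;> simp [h]
  have hσabs : |σ| = 1 := by rcases hσ with h | h <;> simp [h]
  set n : ℤ := (nL κ Φ t p D g f : ℤ)
  set hh : ℤ := hL κ Φ t p D g f
  set ℓ : ℤ := (ℓL κ Φ t p D g f : ℤ)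
  set vα : ℤ := vL κ Φ t p D g f
  set vβ : ℤ := vβL κ Φ t p D g f
  set e : ℤ := (eR κ Φ t p D mk : ℤ)
  set m : ℤ := modulus (nL κ Φ t p D g f) hh vα vβ
  have hm' : m = n * vβ - hh * vα := rfl
  have he : (0 : ℤ) ≤ e := by positivity
  -- the displacements `d₀ := x0 − n`, `s := x1 − σ h` with `|d₀| ≤ e`, `−e ≤ s ≤ ℓ + e`
  have hd0 : |x 0 - n| ≤ e := abs_le.2 ⟨by linarith, by linarith⟩
  have hs : |x 1 - σ * hh| ≤ ℓ + e := abs_le.2 ⟨by linarith [show (0:ℤ) ≤ ℓ by positivity], by linarith⟩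
  constructor
  · -- vβ(σ x0) − vα x1 = σ m + σ vβ (x0 − n) − vα (x1 − σ h)
    have eq : vβ * (σ * x 0) - vα * x 1 = σ * m + σ * (vβ * (x 0 - n)) - vα * (x 1 - σ * hh) := by
      rw [hm']; ring
    rw [eq]
    calc |σ * m + σ * (vβ * (x 0 - n)) - vα * (x 1 - σ * hh)| ≤ |σ * m + σ * (vβ * (x 0 - n))| + |vα * (x 1 - σ * hh)| := abs_sub _ _
      _ ≤ |σ * m| + |σ * (vβ * (x 0 - n))| + |vα * (x 1 - σ * hh)| := by linarith [abs_add_le (σ * m) (σ * (vβ * (x 0 - n)))]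
      _ = m + |vβ| * |x 0 - n| + |vα| * |x 1 - σ * hh| := by rw [abs_mul, abs_mul, abs_mul, abs_mul, hσabs, one_mul, one_mul, abs_of_pos hm]
      _ ≤ m + |vβ| * e + |vα| * (ℓ + e) := by gcongr
      _ ≤ ΛR₀ κ Φ t p D g f mk := by
          unfold ΛR₀
          have : (0 : ℤ) ≤ 3 * n * ℓ := by positivity
          linarith
  · have eq : n * x 1 - hh * (σ * x 0) = n * (x 1 - σ * hh) - σ * (hh * (x 0 - n)) := by
      ring
    rw [eq]
    calc |n * (x 1 - σ * hh) - σ * (hh * (x 0 - n))| ≤ |n * (x 1 - σ * hh)| + |σ * (hh * (x 0 - n))| := abs_sub _ _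
      _ = n * |x 1 - σ * hh| + |hh| * |x 0 - n| := by rw [abs_mul, abs_mul, abs_mul, hσabs, one_mul, Nat.abs_cast]
      _ ≤ n * (ℓ + e) + |hh| * e := by gcongr
      _ ≤ ΛR₁ κ Φ t p D g f mk := by
          unfold ΛR₁
          have : (0 : ℤ) ≤ n * ℓ := by positivity
          nlinarith [abs_nonneg hh]

end Values

/-! ## §3 The sizes at the floors (`g := gT mk gx`): `kR_i ≤ 8Kq·s_i + 1 ≤ 5r_i − 2` -/

section AtT

/-- `pr ≤ 3·(n_b + ℓ_b + |h_b|)`. [folklore] -/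
theorem prB_le (κ : Consts) {V : Type} [Countable V] {G : SimpleGraph V} [G.LocallyFinite] (Φ : PlanarSkeletonFrm G) (t : V) (p : unitInterval) (D : Skelφ.StepI.DataNS V) (mk : ℕ) : prB κ Φ t p D mk ≤ 3 * (nBR κ Φ t p D mk + ℓBR κ Φ t p D mk + (hBR κ Φ t p D mk).natAbs) := by
  unfold prB Skelφ.pgScale; omega

/-- **`5e ≤ M_L`** at `g := gT` (`16·3(n_b+ℓ_b+|h_b|) ≤ 3M_L`, `22000·RA′ ≤ M_L`). [folklore] -/
theorem five_eR_le_ML (κ : Consts) {V : Type} [DecidableEq V] [Countable V] {G : SimpleGraph V} [G.LocallyFinite] (Φ : PlanarSkeletonFrm G) (t : V) (p : unitInterval) (D : Skelφ.StepI.DataNS V) (mk : ℕ) (gx : Neg.FSlot) : 5 * eR κ Φ t p D mk ≤ ML κ Φ t p D (gT mk gx κ Φ t p D) := by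
  obtain ⟨-, h1, h2, -⟩ := ML_floorsT κ Φ t p D mk gx
  have h3 := prB_le κ Φ t p D mk
  unfold eR; omega

/-- **`ΛR₀ ≤ 8m` and `ΛR₁ ≤ 8m`** at `g := gT` (`m > n_L(ℓ_L − 1)`, `5e ≤ M_L < n_L, ℓ_L`, `|v_β| ≤ ℓ_L + 10n_L + 1`, `|v_L| ≤ n_L`, `|h_L| ≤ 10n_L`, `ℓ_L ≥ 9`). [folklore] -/
theorem ΛR_le (κ : Consts) {V : Type} [DecidableEq V] [Countable V] {G : SimpleGraph V} [G.LocallyFinite] (Φ : PlanarSkeletonFrm G) (t : V) (p : unitInterval) (D : Skelφ.StepI.DataNS V) (mk : ℕ) (gx : Neg.FSlot) (f : ℕ) (hN : EqNumL κ Φ t p D (gT mk gx κ Φ t p D) f) (hκ : (hL κ Φ t p D (gT mk gx κ Φ t p D) f).natAbs ≤ 10 * nL κ Φ t p D (gT mk gx κ Φ t p D) f) :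
    ΛR₀ κ Φ t p D (gT mk gx κ Φ t p D) f mk ≤
        8 * modulus (nL κ Φ t p D (gT mk gx κ Φ t p D) f) (hL κ Φ t p D (gT mk gx κ Φ t p D) f) (vL κ Φ t p D (gT mk gx κ Φ t p D) f) (vβL κ Φ t p D (gT mk gx κ Φ t p D) f) ∧
      ΛR₁ κ Φ t p D (gT mk gx κ Φ t p D) f mk ≤
        8 * modulus (nL κ Φ t p D (gT mk gx κ Φ t p D) f) (hL κ Φ t p D (gT mk gx κ Φ t p D) f) (vL κ Φ t p D (gT mk gx κ Φ t p D) f) (vβL κ Φ t p D (gT mk gx κ Φ t p D) f) := by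
  obtain ⟨hn1, hℓ1⟩ := one_le_of_eqNumL κ Φ t p D _ f hN
  have hvβ := abs_vβL_le κ Φ t p D _ f hN hκ
  have hv : |vL κ Φ t p D (gT mk gx κ Φ t p D) f| ≤ nL κ Φ t p D (gT mk gx κ Φ t p D) f := hN.v_le
  have hMn := hN.n_le
  have hMℓ := hN.ℓ_le
  have hm := (Skelφ.NegPrm.modulus_vβOf hn1 (hL κ Φ t p D (gT mk gx κ Φ t p D) f) (ℓL κ Φ t p D (gT mk gx κ Φ t p D) f) (vL κ Φ t p D (gT mk gx κ Φ t p D) f)).1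
  have hκ' : |hL κ Φ t p D (gT mk gx κ Φ t p D) f| ≤ 10 * (nL κ Φ t p D (gT mk gx κ Φ t p D) f : ℤ) := by rw [← Int.natCast_natAbs]; exact_mod_cast hκ
  have h5E : ((5 * eR κ Φ t p D mk : ℕ) : ℤ) ≤ (ML κ Φ t p D (gT mk gx κ Φ t p D) : ℤ) := by exact_mod_cast five_eR_le_ML κ Φ t p D mk gx
  have h22 : ((22000 * (RA' κ Φ t p D mk + 2) : ℕ) : ℤ) ≤ (ML κ Φ t p D (gT mk gx κ Φ t p D) : ℤ) := by exact_mod_cast (ML_floorsT κ Φ t p D mk gx).2.1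
  push_cast at h5E h22
  unfold ΛR₀ ΛR₁
  have e : vβL κ Φ t p D (gT mk gx κ Φ t p D) f =
      Skelφ.NegPrm.vβOf (nL κ Φ t p D (gT mk gx κ Φ t p D) f) (hL κ Φ t p D (gT mk gx κ Φ t p D) f) (ℓL κ Φ t p D (gT mk gx κ Φ t p D) f) (vL κ Φ t p D (gT mk gx κ Φ t p D) f) := rfl
  rw [← e] at hm
  have hE0 : (0 : ℤ) ≤ (eR κ Φ t p D mk : ℤ) := by positivity
  have hℓ9 : (9 : ℤ) ≤ (ℓL κ Φ t p D (gT mk gx κ Φ t p D) f : ℤ) := by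
    have : (0 : ℤ) ≤ (RA' κ Φ t p D mk : ℤ) := by positivity
    linarith
  generalize modulus (nL κ Φ t p D (gT mk gx κ Φ t p D) f) (hL κ Φ t p D (gT mk gx κ Φ t p D) f) (vL κ Φ t p D (gT mk gx κ Φ t p D) f) (vβL κ Φ t p D (gT mk gx κ Φ t p D) f) = m at hm ⊢
  generalize (eR κ Φ t p D mk : ℤ) = E at h5E hE0 ⊢
  generalize (nL κ Φ t p D (gT mk gx κ Φ t p D) f : ℤ) = n at hn1 hvβ hv hMn hm hκ' h5E ⊢
  generalize (ℓL κ Φ t p D (gT mk gx κ Φ t p D) f : ℤ) = ℓ at hℓ1 hvβ hMℓ hm hℓ9 ⊢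
  generalize (ML κ Φ t p D (gT mk gx κ Φ t p D) : ℤ) = M at hMn hMℓ h5E h22 ⊢
  generalize vβL κ Φ t p D (gT mk gx κ Φ t p D) f = vβ at hvβ ⊢
  generalize vL κ Φ t p D (gT mk gx κ Φ t p D) f = vα at hv ⊢
  generalize hL κ Φ t p D (gT mk gx κ Φ t p D) f = hh at hκ' ⊢
  have hn0 : (0 : ℤ) ≤ n := by linarith
  -- the product facts
  have p1 : |vβ| * E ≤ (ℓ + 10 * n + 1) * E := mul_le_mul_of_nonneg_right hvβ hE0
  have p2 : |vα| * (ℓ + E) ≤ n * (ℓ + E) := mul_le_mul_of_nonneg_right hv (by linarith)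
  have p3 : (ℓ + 1) * (5 * E) ≤ (ℓ + 1) * (n - 1) := mul_le_mul_of_nonneg_left (by linarith) (by linarith)
  have p4 : n * (5 * E) ≤ n * (ℓ - 1) := mul_le_mul_of_nonneg_left (by linarith) hn0
  have p5 : (n + |hh|) * E ≤ (11 * n) * E := mul_le_mul_of_nonneg_right (by linarith [abs_nonneg hh]) hE0
  have p6 : n * 8 ≤ n * (ℓ - 1) := mul_le_mul_of_nonneg_left (by linarith) hn0
  constructor
  · nlinarith
  · nlinarith

/-- **`kR₀ ≤ 8Kq·s₀ + 1`, `kR₁ ≤ 8Kq·s₁ + 1`** at `g := gT` (`c_i·800/D = Kq·s_i/m`). [folklore] -/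
theorem kR_le (κ : Consts) {V : Type} [DecidableEq V] [Countable V] {G : SimpleGraph V} [G.LocallyFinite] (Φ : PlanarSkeletonFrm G) (t : V) (p : unitInterval) (D : Skelφ.StepI.DataNS V) (mk : ℕ) (gx : Neg.FSlot) (f : ℕ) (hN : EqNumL κ Φ t p D (gT mk gx κ Φ t p D) f) (hκ : (hL κ Φ t p D (gT mk gx κ Φ t p D) f).natAbs ≤ 10 * nL κ Φ t p D (gT mk gx κ Φ t p D) f) :
    kR₀ κ Φ t p D (gT mk gx κ Φ t p D) f mk ≤ 8 * (Neg.Kq κ : ℤ) * (((fcells κ Φ t p D (gT mk gx κ Φ t p D) f).s 0 : ℕ) : ℤ) + 1 ∧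
      kR₁ κ Φ t p D (gT mk gx κ Φ t p D) f mk ≤ 8 * (Neg.Kq κ : ℤ) * (((fcells κ Φ t p D (gT mk gx κ Φ t p D) f).s 1 : ℕ) : ℤ) + 1 := by
  obtain ⟨hn1, hℓ1⟩ := one_le_of_eqNumL κ Φ t p D _ f hN
  obtain ⟨hΛ0, hΛ1⟩ := ΛR_le κ Φ t p D mk gx f hN hκ
  have hm : 0 < modulus (nL κ Φ t p D (gT mk gx κ Φ t p D) f) (hL κ Φ t p D (gT mk gx κ Φ t p D) f) (vL κ Φ t p D (gT mk gx κ Φ t p D) f)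
      (vβL κ Φ t p D (gT mk gx κ Φ t p D) f) := Skelφ.NegPrm.modulus_vβOf_pos hn1 hℓ1 _ _
  have hK : ((fcells κ Φ t p D (gT mk gx κ Φ t p D) f).K : ℤ) = 40 * (Neg.Kq κ : ℤ) := by
    rw [(fcells_K κ Φ t p D _ f).1, Neg.K_eq]; push_cast; ring
  have key : ∀ (s : ℕ) (Λ : ℤ), Λ ≤ 8 * modulus (nL κ Φ t p D (gT mk gx κ Φ t p D) f) (hL κ Φ t p D (gT mk gx κ Φ t p D) f) (vL κ Φ t p D (gT mk gx κ Φ t p D) f)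
      (vβL κ Φ t p D (gT mk gx κ Φ t p D) f) →
      20 * ((fcells κ Φ t p D (gT mk gx κ Φ t p D) f).K : ℤ) * ((s : ℕ) : ℤ) * (|(800 : ℤ)| * Λ) /
          Skelφ.NegPrm.Dof (nL κ Φ t p D (gT mk gx κ Φ t p D) f) (hL κ Φ t p D (gT mk gx κ Φ t p D) f) (ℓL κ Φ t p D (gT mk gx κ Φ t p D) f) (vL κ Φ t p D (gT mk gx κ Φ t p D) f) ≤
        8 * (Neg.Kq κ : ℤ) * ((s : ℕ) : ℤ) := by
    intro s Λ hΛ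
    rw [Dof_eq_sq_mul, hK, show |(800 : ℤ)| = 800 by norm_num]
    have e1 : 20 * (40 * (Neg.Kq κ : ℤ)) * ((s : ℕ) : ℤ) * (800 * Λ) = 800 ^ 2 * ((Neg.Kq κ : ℤ) * s * Λ) := by ring
    rw [e1, Int.mul_ediv_mul_of_pos _ _ (by norm_num : (0 : ℤ) < 800 ^ 2)]
    refine Int.ediv_le_of_le_mul hm ?_
    have hKs : (0 : ℤ) ≤ (Neg.Kq κ : ℤ) * s := by positivity
    nlinarith
  constructor
  · have h := key ((fcells κ Φ t p D (gT mk gx κ Φ t p D) f).s 0) _ hΛ0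
    show 20 * ((fcells κ Φ t p D (gT mk gx κ Φ t p D) f).K : ℤ) * (((fcells κ Φ t p D (gT mk gx κ Φ t p D) f).s 0 : ℕ) : ℤ) *
        (|(800 : ℤ)| * ΛR₀ κ Φ t p D (gT mk gx κ Φ t p D) f mk) /
          Skelφ.NegPrm.Dof (nL κ Φ t p D (gT mk gx κ Φ t p D) f) (hL κ Φ t p D (gT mk gx κ Φ t p D) f) (ℓL κ Φ t p D (gT mk gx κ Φ t p D) f)
            (vL κ Φ t p D (gT mk gx κ Φ t p D) f) + 1 ≤ _
    linarith
  · have h := key ((fcells κ Φ t p D (gT mk gx κ Φ t p D) f).s 1) _ hΛ1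
    show 20 * ((fcells κ Φ t p D (gT mk gx κ Φ t p D) f).K : ℤ) * (((fcells κ Φ t p D (gT mk gx κ Φ t p D) f).s 1 : ℕ) : ℤ) *
        (|(800 : ℤ)| * ΛR₁ κ Φ t p D (gT mk gx κ Φ t p D) f mk) /
          Skelφ.NegPrm.Dof (nL κ Φ t p D (gT mk gx κ Φ t p D) f) (hL κ Φ t p D (gT mk gx κ Φ t p D) f) (ℓL κ Φ t p D (gT mk gx κ Φ t p D) f)
            (vL κ Φ t p D (gT mk gx κ Φ t p D) f) + 1 ≤ _
    linarith

/-- **`hfR0/hfR1`** at `g := gT`: `−5r₀+1 ≤ −kR₀`, `kR₀ ≤ 25r₀ − 1`, `kR₁ ≤ 5r₁ − 2` (x-family) and `−5r₁+1 ≤ −kR₁`, `kR₁ ≤ 25r₁ − 1`, `kR₀ ≤ 5r₀ − 2`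
(y-family), from `kR_i ≤ 8Kq s_i + 1`, `0 ≤ kR_i − 1` and `r_i = 40Kq·s_i`. [folklore] -/
theorem hfR_R (κ : Consts) {V : Type} [DecidableEq V] [Countable V] {G : SimpleGraph V} [G.LocallyFinite] (Φ : PlanarSkeletonFrm G) (t : V) (p : unitInterval) (D : Skelφ.StepI.DataNS V) (mk : ℕ) (gx : Neg.FSlot) (f : ℕ) (hN : EqNumL κ Φ t p D (gT mk gx κ Φ t p D) f) (hκ : (hL κ Φ t p D (gT mk gx κ Φ t p D) f).natAbs ≤ 10 * nL κ Φ t p D (gT mk gx κ Φ t p D) f) :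
    (-(5 * ((fcells κ Φ t p D (gT mk gx κ Φ t p D) f).r 0 : ℤ)) + 1 ≤ -kR₀ κ Φ t p D (gT mk gx κ Φ t p D) f mk ∧
        kR₀ κ Φ t p D (gT mk gx κ Φ t p D) f mk ≤ 25 * ((fcells κ Φ t p D (gT mk gx κ Φ t p D) f).r 0 : ℤ) - 1 ∧
        kR₁ κ Φ t p D (gT mk gx κ Φ t p D) f mk ≤ 5 * ((fcells κ Φ t p D (gT mk gx κ Φ t p D) f).r 1 : ℤ) - 2) ∧
      (-(5 * ((fcells κ Φ t p D (gT mk gx κ Φ t p D) f).r 1 : ℤ)) + 1 ≤ -kR₁ κ Φ t p D (gT mk gx κ Φ t p D) f mk ∧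
        kR₁ κ Φ t p D (gT mk gx κ Φ t p D) f mk ≤ 25 * ((fcells κ Φ t p D (gT mk gx κ Φ t p D) f).r 1 : ℤ) - 1 ∧
        kR₀ κ Φ t p D (gT mk gx κ Φ t p D) f mk ≤ 5 * ((fcells κ Φ t p D (gT mk gx κ Φ t p D) f).r 0 : ℤ) - 2) := by
  obtain ⟨h0, h1⟩ := kR_le κ Φ t p D mk gx f hN hκ
  have hr := (fcells_K κ Φ t p D (gT mk gx κ Φ t p D) f).2.2
  have hr0 : ((fcells κ Φ t p D (gT mk gx κ Φ t p D) f).r 0 : ℤ) = 40 * (Neg.Kq κ : ℤ) * (((fcells κ Φ t p D (gT mk gx κ Φ t p D) f).s 0 : ℕ) : ℤ) := by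
    rw [hr 0, Neg.K_eq]; push_cast; ring
  have hr1 : ((fcells κ Φ t p D (gT mk gx κ Φ t p D) f).r 1 : ℤ) = 40 * (Neg.Kq κ : ℤ) * (((fcells κ Φ t p D (gT mk gx κ Φ t p D) f).s 1 : ℕ) : ℤ) := by
    rw [hr 1, Neg.K_eq]; push_cast; ring
  have hq : (1 : ℤ) ≤ Neg.Kq κ := by exact_mod_cast Neg.one_le_Kq κ
  have hs0 : (1 : ℤ) ≤ (((fcells κ Φ t p D (gT mk gx κ Φ t p D) f).s 0 : ℕ) : ℤ) := by exact_mod_cast (fcells κ Φ t p D (gT mk gx κ Φ t p D) f).hs 0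
  have hs1 : (1 : ℤ) ≤ (((fcells κ Φ t p D (gT mk gx κ Φ t p D) f).s 1 : ℕ) : ℤ) := by exact_mod_cast (fcells κ Φ t p D (gT mk gx κ Φ t p D) f).hs 1
  have hq0 : (1 : ℤ) ≤ (Neg.Kq κ : ℤ) * (((fcells κ Φ t p D (gT mk gx κ Φ t p D) f).s 0 : ℕ) : ℤ) := by nlinarith
  have hq1 : (1 : ℤ) ≤ (Neg.Kq κ : ℤ) * (((fcells κ Φ t p D (gT mk gx κ Φ t p D) f).s 1 : ℕ) : ℤ) := by nlinarith
  -- `kR_i ≥ 1` (the quotient is nonnegative)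
  obtain ⟨hΛp0, hΛp1⟩ := ΛR_nonneg κ Φ t p D (gT mk gx κ Φ t p D) f mk hN
  obtain ⟨-, -, -, hc₀, hc₁, hD⟩ := prF_pos κ Φ t p D (gT mk gx κ Φ t p D) f hN
  have hk0 : 1 ≤ kR₀ κ Φ t p D (gT mk gx κ Φ t p D) f mk := by
    unfold kR₀
    have : 0 ≤ (prF κ Φ t p D (gT mk gx κ Φ t p D) f).c₀ * (|(prF κ Φ t p D (gT mk gx κ Φ t p D) f).A| * ΛR₀ κ Φ t p D (gT mk gx κ Φ t p D) f mk) /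
        (prF κ Φ t p D (gT mk gx κ Φ t p D) f).D := Int.ediv_nonneg (by positivity) hD.le
    linarith
  have hk1 : 1 ≤ kR₁ κ Φ t p D (gT mk gx κ Φ t p D) f mk := by
    unfold kR₁
    have : 0 ≤ (prF κ Φ t p D (gT mk gx κ Φ t p D) f).c₁ * (|(prF κ Φ t p D (gT mk gx κ Φ t p D) f).A| * ΛR₁ κ Φ t p D (gT mk gx κ Φ t p D) f mk) /
        (prF κ Φ t p D (gT mk gx κ Φ t p D) f).D := Int.ediv_nonneg (by positivity) hD.le
    linarith
  rw [hr0, hr1]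
  refine ⟨⟨by nlinarith, by nlinarith, by nlinarith⟩, ⟨by nlinarith, by nlinarith, by nlinarith⟩⟩

end AtT

end KS

end NegB

end PlanarSkeletonFrm

end Summit.CriticalPhenomena.PercolationContinuityZ3.Theorems.Transplant
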